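import Summits.CriticalPhenomena.Ising3DConformalLimit.Theorems.EnergyNotSigmaSquaredMoebiusLimitExistsWickPowerMoebius
import Summits.CriticalPhenomena.Ising3DConformalLimit.Theorems.MoebiusLimitOfTwoPointLaw.Negative.TwoPointConvergence
import HarnessLib

/-!
# Low orders of cluster points of the pinned critical zoom are free
(line `only-interaction-breaks-moebius`, crux `MoebiusLimitExists`, item stmt-CriticalPhenomena-1344,
route `EnergyNotSigmaSquared`; registered anchor `eqOn_of_ge_four`)

For a cluster point `S` of the pinned zoom of the critical Ising correlators on `ℤ³`
(`IsClusterPoint`, objects file `…MoebiusLimitExistsDefs.lean`):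
* order `0` is the constant `1` (`⟨1⟩_{β_c} = 1`), odd orders vanish on non-coincident configurations
  (`m*(β_c) = 0`: the tree's `criticalCorr_eq_zero_of_odd`), and a REGULAR cluster point vanishes at odd
  orders everywhere;
* hence the two open residues of the line have content only at the even orders `≥ 4`:
  `isInversionCovariant_of_ge_four` (inversion covariance of a regular cluster point with the pure-power
  pair function follows from the inversion identity at even orders `≥ 4` off the diagonals and the
  origin) and `eqOn_of_ge_four` (two cluster points with the same pure-power pair function that agree at
  even orders `≥ 4` agree at every order off the diagonals);

Split out of the line's kernel-checked certificate (skeleton v6, lead c1) by lead c2 so that it lands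
independently of the farm build of the compactness files. No definitions, no `sorry`.
References: M. Aizenman, H. Duminil-Copin, V. Sidoravicius, Comm. Math. Phys. 334 (2015) Thm 1.2
(`m*(β_c) = 0`); P. Di Francesco, P. Mathieu, D. Sénéchal (1997) §4.3.1 (the inversion factor).
-/

noncomputable section

open Filter Topology Set Function Metric
open Literature.Probability.LatticeModels

namespace Summit.CriticalPhenomena.Ising3DConformalLimit.MoebiusLimitExistsOnlyInteraction

/-! ### Low orders of regular cluster points are free (orders `0`, odd, `2`) -/

/-- Order `0` of a cluster point is `1`. [folklore] -/
theorem IsClusterPoint.orderZero_eq_one {S : CorrFamily 3} (hS : IsClusterPoint S)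
    (x : Fin 0 → EuclideanSpace ℝ (Fin 3)) : S 0 x = 1 := by
  obtain ⟨u, -, hconv⟩ := hS
  have hx : x ∈ NonCoincident 3 0 := by
    rw [mem_nonCoincident]; intro i; exact Fin.elim0 i
  have h := (hconv 0).tendsto_at hx
  have h1 : Tendsto (fun k => rescaledCorrelator (criticalCorr 3) rhoPin 0 (u k) x) atTop (𝓝 1) := by
    refine tendsto_const_nhds.congr fun k => ?_
    rw [rescaledCorrelator_apply, pow_zero, one_mul,
      Summit.CriticalPhenomena.Ising3DConformalLimit.Theorems.MoebiusLimitOfTwoPointLaw.Negative.criticalCorr_arity_zero]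
  exact tendsto_nhds_unique h h1

/-- Odd orders of a cluster point vanish on the non-coincident configurations (`m*(β_c) = 0` on `ℤ³`:
`criticalCorr_eq_zero_of_odd`), stated as an `EqOn` with the zero function. [cite: AizenmanDuminilCopinSidoraviciusCMP2015, Thm. 1.2] -/
theorem IsClusterPoint.eqOn_zero_of_odd {S : CorrFamily 3} (hS : IsClusterPoint S) {n : ℕ} (hn : Odd n) :
    (NonCoincident 3 n).EqOn (S n) 0 := by
  intro x hx
  obtain ⟨u, -, hconv⟩ := hS
  have h := (hconv n).tendsto_at hx
  have h0 : Tendsto (fun k => rescaledCorrelator (criticalCorr 3) rhoPin n (u k) x) atTop (𝓝 0) := by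
    refine tendsto_const_nhds.congr fun k => ?_
    rw [rescaledCorrelator_apply, criticalCorr_eq_zero_of_odd (d := 3) le_rfl hn, mul_zero]
  exact tendsto_nhds_unique h h0

/-- A REGULAR cluster point vanishes identically at odd orders (on `NonCoincident` by the lattice, off
it by normalisation). [folklore] -/
theorem eq_zero_of_odd_of_regular {S : CorrFamily 3} (hS : IsClusterPoint S) (hreg : IsRegular S)
    {n : ℕ} (hn : Odd n) (x : Fin n → EuclideanSpace ℝ (Fin 3)) : S n x = 0 := by
  by_cases hx : x ∈ NonCoincident 3 n
  · exact hS.eqOn_zero_of_odd hn hx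
  · exact hreg.1 n x hx

/-! ### The open covariance / uniqueness stubs, cut down to their true locus: even orders `≥ 4` -/



/-- **Inversion covariance of a regular cluster point from its even orders `≥ 4` (the former STUB 5 modulo the residue
5′, here the hypothesis `h5`)**: orders `0` (both sides `1`), odd (both sides `0`), `2` (the pure power transforms with the
gauge `‖p‖^{2Δ}‖q‖^{2Δ}`, `WickPowerMoebius.powerKernel_inversion`) and coincident configurations
(both sides `0` by normalisation, `ι` being injective) are free. [folklore] -/
theorem isInversionCovariant_of_ge_four {Δ : ℝ} {S : CorrFamily 3} (hS : IsClusterPoint S)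
    (hreg : IsRegular S) (h2 : ∀ x ∈ NonCoincident 3 2, S 2 x = ‖x 0 - x 1‖ ^ (-(2 * Δ)))
    (h5 : ∀ m : ℕ, 2 ≤ m → ∀ x : Fin (2 * m) → EuclideanSpace ℝ (Fin 3), x ∈ NonCoincident 3 (2 * m) →
      (∀ i, x i ≠ 0) →
      S (2 * m) (fun i => EuclideanGeometry.inversion 0 1 (x i)) = (∏ i, ‖x i‖ ^ (2 * Δ)) * S (2 * m) x) :
    IsInversionCovariant Δ S := by
  have hι : Function.Injective (EuclideanGeometry.inversion (0 : EuclideanSpace ℝ (Fin 3)) 1) :=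
    EuclideanGeometry.inversion_injective _ one_ne_zero
  intro n x hx0
  rcases Nat.even_or_odd n with ⟨m, hm⟩ | hodd
  · obtain rfl : n = 2 * m := by omega
    by_cases hx : x ∈ NonCoincident 3 (2 * m)
    · rcases Nat.lt_or_ge m 2 with hm2 | hm2
      · interval_cases m
        · rw [hS.orderZero_eq_one, hS.orderZero_eq_one]
          simp
        · have hιx : (fun i => EuclideanGeometry.inversion 0 1 (x i)) ∈ NonCoincident 3 (2 * 1) :=
            (WickPowerMoebius.comp_mem_nonCoincident_iff hι x).2 hx
          rw [h2 _ hιx, h2 _ hx]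
          have hk := WickPowerMoebius.powerKernel_inversion Δ (hx0 0) (hx0 1)
          simp only [powerKernel] at hk
          rw [hk, Fin.prod_univ_two]
      · exact h5 m hm2 x hx hx0
    · have hιx : (fun i => EuclideanGeometry.inversion 0 1 (x i)) ∉ NonCoincident 3 (2 * m) :=
        fun h => hx ((WickPowerMoebius.comp_mem_nonCoincident_iff hι x).1 h)
      rw [hreg.1 _ _ hιx, hreg.1 _ _ hx, mul_zero]
  · rw [eq_zero_of_odd_of_regular hS hreg hodd, eq_zero_of_odd_of_regular hS hreg hodd, mul_zero]

/-- **Two cluster points with the pure-power pair function agreeing at even orders `≥ 4` (hypothesis `h6`, the residue 6′)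
agree at every order off the diagonals**: orders `0`, odd and `2` are free.
[folklore] -/
theorem eqOn_of_ge_four' {Δ : ℝ} {S₁ S₂ : CorrFamily 3} (hS₁ : IsClusterPoint S₁) (hS₂ : IsClusterPoint S₂)
    (h₁ : ∀ x ∈ NonCoincident 3 2, S₁ 2 x = ‖x 0 - x 1‖ ^ (-(2 * Δ)))
    (h₂ : ∀ x ∈ NonCoincident 3 2, S₂ 2 x = ‖x 0 - x 1‖ ^ (-(2 * Δ)))
    (h6 : ∀ m : ℕ, 2 ≤ m → (NonCoincident 3 (2 * m)).EqOn (S₁ (2 * m)) (S₂ (2 * m))) :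
    ∀ n, (NonCoincident 3 n).EqOn (S₁ n) (S₂ n) := by
  intro n x hx
  rcases Nat.even_or_odd n with ⟨m, hm⟩ | hodd
  · obtain rfl : n = 2 * m := by omega
    rcases Nat.lt_or_ge m 2 with hm2 | hm2
    · interval_cases m
      · exact (hS₁.orderZero_eq_one x).trans (hS₂.orderZero_eq_one x).symm
      · exact (h₁ x hx).trans (h₂ x hx).symm
    · exact h6 m hm2 hx
  · exact (hS₁.eqOn_zero_of_odd hodd hx).trans (hS₂.eqOn_zero_of_odd hodd hx).symm

/-- **Registered anchor `eqOn_of_ge_four`** (explicit-binder form of `eqOn_of_ge_four'`): two cluster points with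
the same pure-power pair function agreeing at even orders `≥ 4` agree at every order off the diagonals.
[folklore] -/
theorem eqOn_of_ge_four :
    ∀ (Δ : ℝ) (S₁ S₂ : CorrFamily 3), IsClusterPoint S₁ → IsClusterPoint S₂ →
      (∀ x ∈ NonCoincident 3 2, S₁ 2 x = ‖x 0 - x 1‖ ^ (-(2 * Δ))) →
      (∀ x ∈ NonCoincident 3 2, S₂ 2 x = ‖x 0 - x 1‖ ^ (-(2 * Δ))) →
      (∀ m : ℕ, 2 ≤ m → (NonCoincident 3 (2 * m)).EqOn (S₁ (2 * m)) (S₂ (2 * m))) →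
      ∀ n, (NonCoincident 3 n).EqOn (S₁ n) (S₂ n) :=
  fun _ _ _ hS₁ hS₂ h₁ h₂ h6 => eqOn_of_ge_four' hS₁ hS₂ h₁ h₂ h6

end Summit.CriticalPhenomena.Ising3DConformalLimit.MoebiusLimitExistsOnlyInteraction

end
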